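import Literature.MathematicalPhysics.QuantumFieldTheory.Balaban1983to89.Node00.BgSchemeOfRecordC
import HarnessLib

/-!
# [B11] (109)–(111), (116), Prop. 5–6 pp.293–295 at the scheme of record: THE EULER–LAGRANGE EQUATION AND THE CONSTRAINT OF THE FIXED POINT,
# AT THE REAL AND AT THE COMPLEX SLICE — (116)∕(111) `𝒜 = −𝔊J − 𝔊((δ∕δA′)V)(𝒜 + H₁B)`, the ball (115) `‖𝒜‖ ≤ ε₄`, uniqueness in the ball,
# and (109) `Q𝒜 = 0, RD*𝒜 = 0` from «Q𝔊 = 0, RD*𝔊 = 0» (p.294) — for `(bgSchemeOfRecord …).sol V` AND for M2-ℂ's `solOfRecordC … Z`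
# — OURS (glue over lit ✓`Regime.solA_mem ∕ solA_eq ∕ eq_solA`, ✓`mapT_noLinear`, ✓`constraint102`; file (s2) of ★★★ №553; nothing of Bałaban proved here)

Cell `pub-ymgap`, unit `pub-ymgap-node00-def-Y` (g37; owner∕custodian of the `OpsY` instance at the record; Node00 definition lane;
count-neutral, `--supports stmt-QuantumFields-27238`).  ★★★ director-ym №553: the ONE SUPPLIER of the four P0 letters must expose BY NAME
«(s2) the scheme's EL equation + constraint at the real slice (⇒ (π2)(π3) via ✓`rootedResponseOrbitAt_iff_criticalModGauge`)»; this file is (s2),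
and — since (π2)(π3) differentiate in the datum — the same identities at the COMPLEX slice of M2-ℂ file 1 (✓`Node00.BgSchemeOfRecordC`).

WHAT IS EXPOSED (every analytic input a HYPOTHESIS: a `Regime` of the data at the datum — i.e. 3a's `RegimeTok`, discharged by 3i′
`bgSchemeOfRecord_regimeTok_of` from (117), Prop. 4, (28), (103) — and the slice letter `FrakGSliceTok` «`𝔊(U₀) f ∈ (102)` for every current `f`»,
the slot-(c) reading of [15] p.294 «Q𝔊 = 0, RD*𝔊 = 0», discharged Summit-side from the (3.124) gauge-mode letters as in ✓`…N07FrakGOfRecordSliceFlat`):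
* §0 `constraint102OfRecord` — lit's submodule (102)∕(109) `{A₁ : QA₁ = 0, RD*A₁ = 0}` of the space (115) AT THE RECORD's letters (`Q(U₀)`, `R` from `Q′♭`,
  `D*_{U₀}`), the spelling of ✓`…N07FrakGOfRecordSliceFlat` abbreviated once; the token `FrakGSliceTok`.
* §1 REAL SLICE — `bgSchemeOfRecord_sol_spec` ((115) + fixed point), ★`bgSchemeOfRecord_sol_eq116` (THE EULER–LAGRANGE EQUATION of the scheme in
  its solved form (116)∕(111): `𝒜(V) = −𝔊(U₀)J(U₀) − 𝔊(U₀)W(𝒜(V) + 𝔄(V))`), `bgSchemeOfRecord_eq_sol` (uniqueness in the ball: Prop. 6),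
  ★`bgSchemeOfRecord_sol_mem_constraint102` ((109) for the fixed point), `bgSchemeOfRecord_Q_sol` ∕ `_RDstar_sol` (its two clauses unpacked),
  `bgSchemeOfRecord_Q_chart` ((20) read linearly: `Q(𝒜 + 𝔄) = Q𝔄`, with `Q𝔄 = QH₁B = B` being 3f′ ✓`Q_H1OfRecordAtBg128`).
* §2 COMPLEX SLICE — the same five for `solOfRecordC … Z` (the data do not see the datum; only `‖𝔄ᶜ(Z)‖ < a` is asked): `solOfRecordC_spec`,
  ★`solOfRecordC_eq116`, `eq_solOfRecordC`, ★`solOfRecordC_mem_constraint102`, `solOfRecordC_Q` ∕ `_RDstar`, `solOfRecordC_Q_chart`.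
* §3 the `RegimeTok` corollaries on the domain.

HONEST LABELS.  Glue only: lit ✓`B11Eq174Chart.Regime.solA_mem ∕ solA_eq ∕ eq_solA`, ✓`B11Prop6Scheme.mapT_noLinear`, ✓`B11Eq111FrakG.mem_constraint102_iff`
and submodule closure; `Regime …`, `‖J‖ ≤ j`, `‖𝔄‖ < a`, `FrakGSliceTok` are HYPOTHESES displayed, never asserted; the VARIATIONAL reading of (111) (Prop. 5:
(111) ⇔ criticality (82) of `𝓔(A′) = A(exp(iηA′)U₀)` on the slice (83)) is lit ✓`B11Prop5Model.critical82_iff_eq111` over its model letters and is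
NOT instantiated here (named, not claimed).  No `sorry`, no new axiom, no instance ∕ notation ∕ option.  Nothing here is a claim about the Yang–Mills
mass gap (`Summit.QuantumFields`): finite torus, fixed `ε`; nothing continuum ∕ OS ∕ Clay.
-/

noncomputable section

open scoped Matrix Matrix.Norms.L2Operator InnerProductSpace ComplexConjugate Topology

namespace Literature.MathematicalPhysics.QuantumFieldTheory.Balaban1983to89.Node00

open T4Continuum BlockAveraging
open B9SectCLatticeCarrier (Bond)
open B11Eq103H1Complex (BondL2K SiteL2K QFun DstarFun RLatticeK covDivL2K)
open B11Eq115Space (Space115 NegSize NegSup JetSup levWeight)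
open B11Eq111FrakG (constraint102 mem_constraint102_iff nabla115 jetLinearEquiv jetLinearEquiv_apply)
open B11Prop6Scheme (mapT mapT_noLinear)
open B11Eq174Chart (Regime solA)

section Record

variable (F : T4Family) (N : ℕ) [NeZero N] (K : ℕ) (k : ℕ) (Ω : ℕ → Set (Site (F.P K) 0)) (U₀ : GaugeField (F.P K) 0 (SU N))
variable [Fact (0 < (F.L : ℝ))] [Fact (0 < (F.P K).eta k)] [Fact (0 < c0Rec F K k)] [Fact (∀ c, 0 < wBRec F K k c)]

/-! ## §0. The constraint subspace (102)∕(109) at the record and the slice letter of `𝔊(U₀)` -/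

/-- **THE SLICE (102)∕(109) AT THE RECORD**: lit's `constraint102` — `{A₁ : QA₁ = 0, RD*A₁ = 0}` as a complex submodule of the space (115) — at the record's
averaging `Q(U₀)`, Landau-gauge `R` (from `Q′♭`) and covariant divergence `D*_{U₀}` (the spelling of ✓`…N07FrakGOfRecordSliceFlat`, abbreviated).
[cite: Balaban1985Variational, (102) p.293, (109) p.294, (21) p.281] -/
abbrev constraint102OfRecord : Submodule ℂ (Space115Lit F N K k Ω U₀) :=
  constraint102 (L := (F.L : ℝ)) (η := (F.P K).eta k) (lev₀ := bondLevLit F Ω k) (pairLevLit F Ω k)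
    (nabla115 ((F.P K).eta k) (unitsOfRecord F N U₀)) (QFun (phiRec N) (QOfRecord F N k U₀))
    (RLatticeK (cRec F K k) (RRec F N U₀) (SRec F N U₀) (QflatOfRecord F N k))
    (DstarFun (phiRec N) (covDivL2K ℂ (c0Rec F K k) (cRec F K k) (SRec F N U₀)))

section Slots

variable (levB : PBond (F.P K) k → ℕ)
  (Gp : SiteL2K ℂ (F.P K).d (fun _ => (F.P K).sitesPerDir 0) (c0Rec F K k) (WRec N) →ₗ[ℂ]
    SiteL2K ℂ (F.P K).d (fun _ => (F.P K).sitesPerDir 0) (c0Rec F K k) (WRec N))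
  (Δ2 : BondL2K ℂ (F.P K).d (fun _ => (F.P K).sitesPerDir 0) (c0Rec F K k) (WRec N) →ₗ[ℂ]
    BondL2K ℂ (F.P K).d (fun _ => (F.P K).sitesPerDir 0) (c0Rec F K k) (WRec N)) (a : ℝ)
  (hposπ : ∀ x, x ≠ 0 → 0 < RCLike.re ⟪x, laplaceAOfRecordAt F N k U₀ (hessOpOfRecord128 F N k U₀ Gp (QflatOfRecord F N k) Δ2)
    (QOfRecord F N k U₀) (QflatOfRecord F N k) a x⟫_ℂ)
  (hposb : ∀ x, x ≠ 0 → 0 < RCLike.re ⟪x, laplaceAOfRecord F N k U₀ (QOfRecord F N k U₀) (QflatOfRecord F N k) a x⟫_ℂ)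
  (hQ : Function.Surjective (QOfRecord F N k U₀))

/-- **TOKEN «Q𝔊 = 0, RD*𝔊 = 0» AT SLOT (c)** ([15] p.294, for the slot-(c) `𝔊(U₀) = frakGOfRecordAtBg128`): every `𝔊(U₀)f` lies in the slice (102).  DISPLAYED —
asserts nothing; discharged Summit-side from the (3.124) gauge-mode letters (g1), (g2), the symmetric Hessian and the record's adjoint transporters by lit
✓`B9Eq3124GaugeModes.frakGLatticeCLM_mem_constraint102_of_gaugeModes` (as ✓`…N07FrakGOfRecordSliceFlat` does at slot (a)).
[cite: Balaban1985Variational, (110)–(111) p.294; Balaban1985BackgroundPropagators, (3.124) p.420] -/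
def FrakGSliceTok : Prop :=
  ∀ f, frakGOfRecordAtBg128 F N K k Ω U₀ Gp Δ2 a hposπ hQ f ∈ constraint102OfRecord F N K k Ω U₀

/-! ## §1. The real slice: the fixed point `𝒜(V) = (bgSchemeOfRecord …).sol V` -/

/-- **(115) + THE FIXED-POINT PROPERTY at the real slice**: under a regime of the data and the data bounds, `‖𝒜(V)‖ ≤ ε₄` and `𝒜(V)` is a fixed point of (116)'s
map `T = mapT 𝔊 0 W J 𝔄(V)` (lit ✓`Regime.solA_mem`). [cite: Balaban1985Variational, Prop. 6 (115)–(116) p.295] -/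
theorem bgSchemeOfRecord_sol_spec (dom : Set (GaugeField (F.P K) k (SU N))) {εC B₀ C₄ a₃ j a𝔄 ε₄ : ℝ}
    (R : Regime (frakGOfRecordAtBg128 F N K k Ω U₀ Gp Δ2 a hposπ hQ) (0 : Space115Lit F N K k Ω U₀ →L[ℂ] Space115Lit F N K k Ω U₀)
      (WOfRecordAt F N K k Ω U₀ levB a hposb hQ εC Gp) B₀ 0 C₄ a₃ j a𝔄 ε₄)
    (hJ : ‖JOfRecordAtBg F N K k Ω U₀‖ ≤ j) {V : GaugeField (F.P K) k (SU N)} (h𝔄 : ‖frakAOfRecordAtBg128 F N K k Ω U₀ levB Gp Δ2 a hposπ hQ V‖ < a𝔄) :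
    ‖(bgSchemeOfRecord F N K k Ω U₀ dom levB Gp Δ2 a hposπ hposb hQ εC B₀ C₄ a₃ j a𝔄 ε₄).sol V‖ ≤ ε₄ ∧
      mapT (frakGOfRecordAtBg128 F N K k Ω U₀ Gp Δ2 a hposπ hQ) 0 (WOfRecordAt F N K k Ω U₀ levB a hposb hQ εC Gp) (JOfRecordAtBg F N K k Ω U₀)
        (frakAOfRecordAtBg128 F N K k Ω U₀ levB Gp Δ2 a hposπ hQ V) ((bgSchemeOfRecord F N K k Ω U₀ dom levB Gp Δ2 a hposπ hposb hQ εC B₀ C₄ a₃ j a𝔄 ε₄).sol V)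
        = (bgSchemeOfRecord F N K k Ω U₀ dom levB Gp Δ2 a hposπ hposb hQ εC B₀ C₄ a₃ j a𝔄 ε₄).sol V :=
  R.solA_mem hJ h𝔄

/-- ★★ **THE EULER–LAGRANGE EQUATION OF THE SCHEME OF RECORD, SOLVED FORM (116)∕(111)**: `𝒜(V) = −𝔊(U₀)J(U₀) − 𝔊(U₀)((δ∕δA′)V)(𝒜(V) + H₁B(V))` — print's
«𝒜 = −𝔊J − 𝔊(…)» for the record's letters in every slot (lit ✓`Regime.solA_mem` + ✓`mapT_noLinear`).  By Prop. 5 this is the equation whose solutions give, through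
(112), the critical configurations of `A` on the slice (19)–(21) (lit ✓`B11Prop5Model.critical82_iff_eq111`, not instantiated here).
[cite: Balaban1985Variational, (111) p.294, (116) p.295, Prop. 5 p.294] -/
theorem bgSchemeOfRecord_sol_eq116 (dom : Set (GaugeField (F.P K) k (SU N))) {εC B₀ C₄ a₃ j a𝔄 ε₄ : ℝ}
    (R : Regime (frakGOfRecordAtBg128 F N K k Ω U₀ Gp Δ2 a hposπ hQ) (0 : Space115Lit F N K k Ω U₀ →L[ℂ] Space115Lit F N K k Ω U₀)
      (WOfRecordAt F N K k Ω U₀ levB a hposb hQ εC Gp) B₀ 0 C₄ a₃ j a𝔄 ε₄)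
    (hJ : ‖JOfRecordAtBg F N K k Ω U₀‖ ≤ j) {V : GaugeField (F.P K) k (SU N)} (h𝔄 : ‖frakAOfRecordAtBg128 F N K k Ω U₀ levB Gp Δ2 a hposπ hQ V‖ < a𝔄) :
    (bgSchemeOfRecord F N K k Ω U₀ dom levB Gp Δ2 a hposπ hposb hQ εC B₀ C₄ a₃ j a𝔄 ε₄).sol V =
      -(frakGOfRecordAtBg128 F N K k Ω U₀ Gp Δ2 a hposπ hQ (JOfRecordAtBg F N K k Ω U₀)) -
        frakGOfRecordAtBg128 F N K k Ω U₀ Gp Δ2 a hposπ hQ (WOfRecordAt F N K k Ω U₀ levB a hposb hQ εC Gp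
          ((bgSchemeOfRecord F N K k Ω U₀ dom levB Gp Δ2 a hposπ hposb hQ εC B₀ C₄ a₃ j a𝔄 ε₄).sol V + frakAOfRecordAtBg128 F N K k Ω U₀ levB Gp Δ2 a hposπ hQ V)) := by
  have h := (bgSchemeOfRecord_sol_spec F N K k Ω U₀ levB Gp Δ2 a hposπ hposb hQ dom R hJ h𝔄).2
  rw [mapT_noLinear] at h
  exact h.symm

/-- **UNIQUENESS IN THE BALL (Prop. 6)**: any fixed point of (116)'s map with `‖X‖ ≤ ε₄` IS `𝒜(V)` (lit ✓`Regime.eq_solA`). [cite: Balaban1985Variational, Prop. 6 p.295] -/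
theorem bgSchemeOfRecord_eq_sol (dom : Set (GaugeField (F.P K) k (SU N))) {εC B₀ C₄ a₃ j a𝔄 ε₄ : ℝ}
    (R : Regime (frakGOfRecordAtBg128 F N K k Ω U₀ Gp Δ2 a hposπ hQ) (0 : Space115Lit F N K k Ω U₀ →L[ℂ] Space115Lit F N K k Ω U₀)
      (WOfRecordAt F N K k Ω U₀ levB a hposb hQ εC Gp) B₀ 0 C₄ a₃ j a𝔄 ε₄)
    (hJ : ‖JOfRecordAtBg F N K k Ω U₀‖ ≤ j) {V : GaugeField (F.P K) k (SU N)} (h𝔄 : ‖frakAOfRecordAtBg128 F N K k Ω U₀ levB Gp Δ2 a hposπ hQ V‖ < a𝔄)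
    {X : Space115Lit F N K k Ω U₀} (hX : ‖X‖ ≤ ε₄)
    (hfix : mapT (frakGOfRecordAtBg128 F N K k Ω U₀ Gp Δ2 a hposπ hQ) 0 (WOfRecordAt F N K k Ω U₀ levB a hposb hQ εC Gp) (JOfRecordAtBg F N K k Ω U₀)
      (frakAOfRecordAtBg128 F N K k Ω U₀ levB Gp Δ2 a hposπ hQ V) X = X) :
    X = (bgSchemeOfRecord F N K k Ω U₀ dom levB Gp Δ2 a hposπ hposb hQ εC B₀ C₄ a₃ j a𝔄 ε₄).sol V :=
  R.eq_solA hJ h𝔄 hX hfix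

/-- ★★ **(109) FOR THE FIXED POINT: `𝒜(V) ∈ (102)`, i.e. `Q𝒜(V) = 0`, `RD*𝒜(V) = 0`** — «any solution of (110) satisfies automatically Eq. (108), (109)»: by (116)
`𝒜 = −𝔊J − 𝔊W(…)` and the slice letter «Q𝔊 = 0, RD*𝔊 = 0» (`FrakGSliceTok`, displayed), submodule closure.
[cite: Balaban1985Variational, (109)–(111) p.294, Prop. 6 p.295] -/
theorem bgSchemeOfRecord_sol_mem_constraint102 (dom : Set (GaugeField (F.P K) k (SU N))) {εC B₀ C₄ a₃ j a𝔄 ε₄ : ℝ}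
    (R : Regime (frakGOfRecordAtBg128 F N K k Ω U₀ Gp Δ2 a hposπ hQ) (0 : Space115Lit F N K k Ω U₀ →L[ℂ] Space115Lit F N K k Ω U₀)
      (WOfRecordAt F N K k Ω U₀ levB a hposb hQ εC Gp) B₀ 0 C₄ a₃ j a𝔄 ε₄)
    (hJ : ‖JOfRecordAtBg F N K k Ω U₀‖ ≤ j) {V : GaugeField (F.P K) k (SU N)} (h𝔄 : ‖frakAOfRecordAtBg128 F N K k Ω U₀ levB Gp Δ2 a hposπ hQ V‖ < a𝔄)
    (h𝔊 : FrakGSliceTok F N K k Ω U₀ Gp Δ2 a hposπ hQ) :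
    (bgSchemeOfRecord F N K k Ω U₀ dom levB Gp Δ2 a hposπ hposb hQ εC B₀ C₄ a₃ j a𝔄 ε₄).sol V ∈ constraint102OfRecord F N K k Ω U₀ := by
  rw [bgSchemeOfRecord_sol_eq116 F N K k Ω U₀ levB Gp Δ2 a hposπ hposb hQ dom R hJ h𝔄]
  exact Submodule.sub_mem _ (Submodule.neg_mem _ (h𝔊 _)) (h𝔊 _)

/-- (109), FIRST CLAUSE: `Q𝒜(V) = 0` on the underlying bond function. [cite: Balaban1985Variational, (109) p.294] -/
theorem bgSchemeOfRecord_Q_sol (dom : Set (GaugeField (F.P K) k (SU N))) {εC B₀ C₄ a₃ j a𝔄 ε₄ : ℝ}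
    (R : Regime (frakGOfRecordAtBg128 F N K k Ω U₀ Gp Δ2 a hposπ hQ) (0 : Space115Lit F N K k Ω U₀ →L[ℂ] Space115Lit F N K k Ω U₀)
      (WOfRecordAt F N K k Ω U₀ levB a hposb hQ εC Gp) B₀ 0 C₄ a₃ j a𝔄 ε₄)
    (hJ : ‖JOfRecordAtBg F N K k Ω U₀‖ ≤ j) {V : GaugeField (F.P K) k (SU N)} (h𝔄 : ‖frakAOfRecordAtBg128 F N K k Ω U₀ levB Gp Δ2 a hposπ hQ V‖ < a𝔄)
    (h𝔊 : FrakGSliceTok F N K k Ω U₀ Gp Δ2 a hposπ hQ) :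
    QFun (phiRec N) (QOfRecord F N k U₀)
      (JetSup.equiv _ _ (nabla115 ((F.P K).eta k) (unitsOfRecord F N U₀))
        ((bgSchemeOfRecord F N K k Ω U₀ dom levB Gp Δ2 a hposπ hposb hQ εC B₀ C₄ a₃ j a𝔄 ε₄).sol V)) = 0 :=
  ((mem_constraint102_iff _ _ _ _ _ _).1 (bgSchemeOfRecord_sol_mem_constraint102 F N K k Ω U₀ levB Gp Δ2 a hposπ hposb hQ dom R hJ h𝔄 h𝔊)).1

/-- (109), SECOND CLAUSE (Landau gauge (21)): `RD*𝒜(V) = 0`. [cite: Balaban1985Variational, (109) p.294, (21) p.281] -/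
theorem bgSchemeOfRecord_RDstar_sol (dom : Set (GaugeField (F.P K) k (SU N))) {εC B₀ C₄ a₃ j a𝔄 ε₄ : ℝ}
    (R : Regime (frakGOfRecordAtBg128 F N K k Ω U₀ Gp Δ2 a hposπ hQ) (0 : Space115Lit F N K k Ω U₀ →L[ℂ] Space115Lit F N K k Ω U₀)
      (WOfRecordAt F N K k Ω U₀ levB a hposb hQ εC Gp) B₀ 0 C₄ a₃ j a𝔄 ε₄)
    (hJ : ‖JOfRecordAtBg F N K k Ω U₀‖ ≤ j) {V : GaugeField (F.P K) k (SU N)} (h𝔄 : ‖frakAOfRecordAtBg128 F N K k Ω U₀ levB Gp Δ2 a hposπ hQ V‖ < a𝔄)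
    (h𝔊 : FrakGSliceTok F N K k Ω U₀ Gp Δ2 a hposπ hQ) :
    RLatticeK (cRec F K k) (RRec F N U₀) (SRec F N U₀) (QflatOfRecord F N k)
      (DstarFun (phiRec N) (covDivL2K ℂ (c0Rec F K k) (cRec F K k) (SRec F N U₀))
        (JetSup.equiv _ _ (nabla115 ((F.P K).eta k) (unitsOfRecord F N U₀))
          ((bgSchemeOfRecord F N K k Ω U₀ dom levB Gp Δ2 a hposπ hposb hQ εC B₀ C₄ a₃ j a𝔄 ε₄).sol V))) = 0 :=
  ((mem_constraint102_iff _ _ _ _ _ _).1 (bgSchemeOfRecord_sol_mem_constraint102 F N K k Ω U₀ levB Gp Δ2 a hposπ hposb hQ dom R hJ h𝔄 h𝔊)).2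

/-- **(20) READ LINEARLY ON THE CHART FIELD `A′ = 𝒜 + 𝔄`**: `Q(𝒜(V) + 𝔄(V)) = Q𝔄(V)` — the fluctuation is `Q`-invisible ((109)), so the block-average constraint of the
chart field is carried by `𝔄 = H₁B` alone, whose value `QH₁B = B(V)` is 3f′ ✓`Q_H1OfRecordAtBg128` ((45), hypothesis-free).
[cite: Balaban1985Variational, (20) p.281, (45) p.285, (103) p.293, (109) p.294] -/
theorem bgSchemeOfRecord_Q_chart (dom : Set (GaugeField (F.P K) k (SU N))) {εC B₀ C₄ a₃ j a𝔄 ε₄ : ℝ}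
    (R : Regime (frakGOfRecordAtBg128 F N K k Ω U₀ Gp Δ2 a hposπ hQ) (0 : Space115Lit F N K k Ω U₀ →L[ℂ] Space115Lit F N K k Ω U₀)
      (WOfRecordAt F N K k Ω U₀ levB a hposb hQ εC Gp) B₀ 0 C₄ a₃ j a𝔄 ε₄)
    (hJ : ‖JOfRecordAtBg F N K k Ω U₀‖ ≤ j) {V : GaugeField (F.P K) k (SU N)} (h𝔄 : ‖frakAOfRecordAtBg128 F N K k Ω U₀ levB Gp Δ2 a hposπ hQ V‖ < a𝔄)
    (h𝔊 : FrakGSliceTok F N K k Ω U₀ Gp Δ2 a hposπ hQ) :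
    QFun (phiRec N) (QOfRecord F N k U₀)
      (JetSup.equiv _ _ (nabla115 ((F.P K).eta k) (unitsOfRecord F N U₀))
        ((bgSchemeOfRecord F N K k Ω U₀ dom levB Gp Δ2 a hposπ hposb hQ εC B₀ C₄ a₃ j a𝔄 ε₄).sol V + frakAOfRecordAtBg128 F N K k Ω U₀ levB Gp Δ2 a hposπ hQ V)) =
      QFun (phiRec N) (QOfRecord F N k U₀)
        (JetSup.equiv _ _ (nabla115 ((F.P K).eta k) (unitsOfRecord F N U₀)) (frakAOfRecordAtBg128 F N K k Ω U₀ levB Gp Δ2 a hposπ hQ V)) := by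
  have e := map_add (jetLinearEquiv (F.L : ℝ) ((F.P K).eta k) (bondLevLit F Ω k) (pairLevLit F Ω k) (nabla115 ((F.P K).eta k) (unitsOfRecord F N U₀)))
    ((bgSchemeOfRecord F N K k Ω U₀ dom levB Gp Δ2 a hposπ hposb hQ εC B₀ C₄ a₃ j a𝔄 ε₄).sol V) (frakAOfRecordAtBg128 F N K k Ω U₀ levB Gp Δ2 a hposπ hQ V)
  simp only [jetLinearEquiv_apply] at e
  rw [e, map_add, bgSchemeOfRecord_Q_sol F N K k Ω U₀ levB Gp Δ2 a hposπ hposb hQ dom R hJ h𝔄 h𝔊, zero_add]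

/-! ## §2. The complex slice: the fixed point `𝒜ᶜ(Z) = solOfRecordC … Z` of M2-ℂ file 1 -/

/-- **(115) + THE FIXED-POINT PROPERTY at the complex slice** — the data do not see the datum; only `‖𝔄ᶜ(Z)‖ < a` is asked. [cite: Balaban1985Variational, Prop. 6 (115)–(116) p.295, Prop. 9 p.309] -/
theorem solOfRecordC_spec {εC B₀ C₄ a₃ j a𝔄 ε₄ : ℝ}
    (R : Regime (frakGOfRecordAtBg128 F N K k Ω U₀ Gp Δ2 a hposπ hQ) (0 : Space115Lit F N K k Ω U₀ →L[ℂ] Space115Lit F N K k Ω U₀)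
      (WOfRecordAt F N K k Ω U₀ levB a hposb hQ εC Gp) B₀ 0 C₄ a₃ j a𝔄 ε₄)
    (hJ : ‖JOfRecordAtBg F N K k Ω U₀‖ ≤ j) {Z : PBond (F.P K) k → Matrix (Fin N) (Fin N) ℂ}
    (h𝔄 : ‖frakAOfRecordAtBg128C F N K k Ω U₀ levB Gp Δ2 a hposπ hQ Z‖ < a𝔄) :
    ‖solOfRecordC F N K k Ω U₀ levB Gp Δ2 a hposπ hposb hQ εC ε₄ Z‖ ≤ ε₄ ∧
      mapT (frakGOfRecordAtBg128 F N K k Ω U₀ Gp Δ2 a hposπ hQ) 0 (WOfRecordAt F N K k Ω U₀ levB a hposb hQ εC Gp) (JOfRecordAtBg F N K k Ω U₀)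
        (frakAOfRecordAtBg128C F N K k Ω U₀ levB Gp Δ2 a hposπ hQ Z) (solOfRecordC F N K k Ω U₀ levB Gp Δ2 a hposπ hposb hQ εC ε₄ Z)
        = solOfRecordC F N K k Ω U₀ levB Gp Δ2 a hposπ hposb hQ εC ε₄ Z :=
  R.solA_mem hJ h𝔄

/-- ★★ **THE EULER–LAGRANGE EQUATION (116)∕(111) AT THE COMPLEX SLICE**: `𝒜ᶜ(Z) = −𝔊(U₀)J(U₀) − 𝔊(U₀)W(𝒜ᶜ(Z) + 𝔄ᶜ(Z))` — print's «solution of the equations for an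
analytic extension of a critical point» (Prop. 9): the SAME equation, the shift evaluated on the complex datum.
[cite: Balaban1985Variational, (111) p.294, (116) p.295, Prop. 9 p.309] -/
theorem solOfRecordC_eq116 {εC B₀ C₄ a₃ j a𝔄 ε₄ : ℝ}
    (R : Regime (frakGOfRecordAtBg128 F N K k Ω U₀ Gp Δ2 a hposπ hQ) (0 : Space115Lit F N K k Ω U₀ →L[ℂ] Space115Lit F N K k Ω U₀)
      (WOfRecordAt F N K k Ω U₀ levB a hposb hQ εC Gp) B₀ 0 C₄ a₃ j a𝔄 ε₄)
    (hJ : ‖JOfRecordAtBg F N K k Ω U₀‖ ≤ j) {Z : PBond (F.P K) k → Matrix (Fin N) (Fin N) ℂ}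
    (h𝔄 : ‖frakAOfRecordAtBg128C F N K k Ω U₀ levB Gp Δ2 a hposπ hQ Z‖ < a𝔄) :
    solOfRecordC F N K k Ω U₀ levB Gp Δ2 a hposπ hposb hQ εC ε₄ Z =
      -(frakGOfRecordAtBg128 F N K k Ω U₀ Gp Δ2 a hposπ hQ (JOfRecordAtBg F N K k Ω U₀)) -
        frakGOfRecordAtBg128 F N K k Ω U₀ Gp Δ2 a hposπ hQ (WOfRecordAt F N K k Ω U₀ levB a hposb hQ εC Gp
          (solOfRecordC F N K k Ω U₀ levB Gp Δ2 a hposπ hposb hQ εC ε₄ Z + frakAOfRecordAtBg128C F N K k Ω U₀ levB Gp Δ2 a hposπ hQ Z)) := by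
  have h := (solOfRecordC_spec F N K k Ω U₀ levB Gp Δ2 a hposπ hposb hQ R hJ h𝔄).2
  rw [mapT_noLinear] at h
  exact h.symm

/-- **UNIQUENESS IN THE BALL at the complex slice (Prop. 6)**. [cite: Balaban1985Variational, Prop. 6 p.295, Prop. 9 p.309] -/
theorem eq_solOfRecordC {εC B₀ C₄ a₃ j a𝔄 ε₄ : ℝ}
    (R : Regime (frakGOfRecordAtBg128 F N K k Ω U₀ Gp Δ2 a hposπ hQ) (0 : Space115Lit F N K k Ω U₀ →L[ℂ] Space115Lit F N K k Ω U₀)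
      (WOfRecordAt F N K k Ω U₀ levB a hposb hQ εC Gp) B₀ 0 C₄ a₃ j a𝔄 ε₄)
    (hJ : ‖JOfRecordAtBg F N K k Ω U₀‖ ≤ j) {Z : PBond (F.P K) k → Matrix (Fin N) (Fin N) ℂ}
    (h𝔄 : ‖frakAOfRecordAtBg128C F N K k Ω U₀ levB Gp Δ2 a hposπ hQ Z‖ < a𝔄) {X : Space115Lit F N K k Ω U₀} (hX : ‖X‖ ≤ ε₄)
    (hfix : mapT (frakGOfRecordAtBg128 F N K k Ω U₀ Gp Δ2 a hposπ hQ) 0 (WOfRecordAt F N K k Ω U₀ levB a hposb hQ εC Gp) (JOfRecordAtBg F N K k Ω U₀)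
      (frakAOfRecordAtBg128C F N K k Ω U₀ levB Gp Δ2 a hposπ hQ Z) X = X) :
    X = solOfRecordC F N K k Ω U₀ levB Gp Δ2 a hposπ hposb hQ εC ε₄ Z :=
  R.eq_solA hJ h𝔄 hX hfix

/-- ★★ **(109) AT THE COMPLEX SLICE: `𝒜ᶜ(Z) ∈ (102)`** — `Q𝒜ᶜ(Z) = 0`, `RD*𝒜ᶜ(Z) = 0` — from (116) and the slice letter of `𝔊(U₀)`.
[cite: Balaban1985Variational, (109)–(111) p.294, Prop. 9 p.309] -/
theorem solOfRecordC_mem_constraint102 {εC B₀ C₄ a₃ j a𝔄 ε₄ : ℝ}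
    (R : Regime (frakGOfRecordAtBg128 F N K k Ω U₀ Gp Δ2 a hposπ hQ) (0 : Space115Lit F N K k Ω U₀ →L[ℂ] Space115Lit F N K k Ω U₀)
      (WOfRecordAt F N K k Ω U₀ levB a hposb hQ εC Gp) B₀ 0 C₄ a₃ j a𝔄 ε₄)
    (hJ : ‖JOfRecordAtBg F N K k Ω U₀‖ ≤ j) {Z : PBond (F.P K) k → Matrix (Fin N) (Fin N) ℂ}
    (h𝔄 : ‖frakAOfRecordAtBg128C F N K k Ω U₀ levB Gp Δ2 a hposπ hQ Z‖ < a𝔄) (h𝔊 : FrakGSliceTok F N K k Ω U₀ Gp Δ2 a hposπ hQ) :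
    solOfRecordC F N K k Ω U₀ levB Gp Δ2 a hposπ hposb hQ εC ε₄ Z ∈ constraint102OfRecord F N K k Ω U₀ := by
  rw [solOfRecordC_eq116 F N K k Ω U₀ levB Gp Δ2 a hposπ hposb hQ R hJ h𝔄]
  exact Submodule.sub_mem _ (Submodule.neg_mem _ (h𝔊 _)) (h𝔊 _)

/-- (109) at the complex slice, FIRST CLAUSE: `Q𝒜ᶜ(Z) = 0`. [cite: Balaban1985Variational, (109) p.294, Prop. 9 p.309] -/
theorem solOfRecordC_Q {εC B₀ C₄ a₃ j a𝔄 ε₄ : ℝ}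
    (R : Regime (frakGOfRecordAtBg128 F N K k Ω U₀ Gp Δ2 a hposπ hQ) (0 : Space115Lit F N K k Ω U₀ →L[ℂ] Space115Lit F N K k Ω U₀)
      (WOfRecordAt F N K k Ω U₀ levB a hposb hQ εC Gp) B₀ 0 C₄ a₃ j a𝔄 ε₄)
    (hJ : ‖JOfRecordAtBg F N K k Ω U₀‖ ≤ j) {Z : PBond (F.P K) k → Matrix (Fin N) (Fin N) ℂ}
    (h𝔄 : ‖frakAOfRecordAtBg128C F N K k Ω U₀ levB Gp Δ2 a hposπ hQ Z‖ < a𝔄) (h𝔊 : FrakGSliceTok F N K k Ω U₀ Gp Δ2 a hposπ hQ) :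
    QFun (phiRec N) (QOfRecord F N k U₀)
      (JetSup.equiv _ _ (nabla115 ((F.P K).eta k) (unitsOfRecord F N U₀)) (solOfRecordC F N K k Ω U₀ levB Gp Δ2 a hposπ hposb hQ εC ε₄ Z)) = 0 :=
  ((mem_constraint102_iff _ _ _ _ _ _).1 (solOfRecordC_mem_constraint102 F N K k Ω U₀ levB Gp Δ2 a hposπ hposb hQ R hJ h𝔄 h𝔊)).1

/-- (109) at the complex slice, SECOND CLAUSE: `RD*𝒜ᶜ(Z) = 0`. [cite: Balaban1985Variational, (109) p.294, (21) p.281, Prop. 9 p.309] -/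
theorem solOfRecordC_RDstar {εC B₀ C₄ a₃ j a𝔄 ε₄ : ℝ}
    (R : Regime (frakGOfRecordAtBg128 F N K k Ω U₀ Gp Δ2 a hposπ hQ) (0 : Space115Lit F N K k Ω U₀ →L[ℂ] Space115Lit F N K k Ω U₀)
      (WOfRecordAt F N K k Ω U₀ levB a hposb hQ εC Gp) B₀ 0 C₄ a₃ j a𝔄 ε₄)
    (hJ : ‖JOfRecordAtBg F N K k Ω U₀‖ ≤ j) {Z : PBond (F.P K) k → Matrix (Fin N) (Fin N) ℂ}
    (h𝔄 : ‖frakAOfRecordAtBg128C F N K k Ω U₀ levB Gp Δ2 a hposπ hQ Z‖ < a𝔄) (h𝔊 : FrakGSliceTok F N K k Ω U₀ Gp Δ2 a hposπ hQ) :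
    RLatticeK (cRec F K k) (RRec F N U₀) (SRec F N U₀) (QflatOfRecord F N k)
      (DstarFun (phiRec N) (covDivL2K ℂ (c0Rec F K k) (cRec F K k) (SRec F N U₀))
        (JetSup.equiv _ _ (nabla115 ((F.P K).eta k) (unitsOfRecord F N U₀)) (solOfRecordC F N K k Ω U₀ levB Gp Δ2 a hposπ hposb hQ εC ε₄ Z))) = 0 :=
  ((mem_constraint102_iff _ _ _ _ _ _).1 (solOfRecordC_mem_constraint102 F N K k Ω U₀ levB Gp Δ2 a hposπ hposb hQ R hJ h𝔄 h𝔊)).2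

/-- **(20) READ LINEARLY AT THE COMPLEX SLICE**: `Q(𝒜ᶜ(Z) + 𝔄ᶜ(Z)) = Q𝔄ᶜ(Z)` (and `Q𝔄ᶜ(Z) = QH₁Bᶜ(Z) = Bᶜ(Z)` is 3f′ ✓`Q_H1OfRecordAtBg128` at `B := BOfRecordC … Z`).
[cite: Balaban1985Variational, (20) p.281, (45) p.285, (109) p.294, Prop. 9 p.309] -/
theorem solOfRecordC_Q_chart {εC B₀ C₄ a₃ j a𝔄 ε₄ : ℝ}
    (R : Regime (frakGOfRecordAtBg128 F N K k Ω U₀ Gp Δ2 a hposπ hQ) (0 : Space115Lit F N K k Ω U₀ →L[ℂ] Space115Lit F N K k Ω U₀)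
      (WOfRecordAt F N K k Ω U₀ levB a hposb hQ εC Gp) B₀ 0 C₄ a₃ j a𝔄 ε₄)
    (hJ : ‖JOfRecordAtBg F N K k Ω U₀‖ ≤ j) {Z : PBond (F.P K) k → Matrix (Fin N) (Fin N) ℂ}
    (h𝔄 : ‖frakAOfRecordAtBg128C F N K k Ω U₀ levB Gp Δ2 a hposπ hQ Z‖ < a𝔄) (h𝔊 : FrakGSliceTok F N K k Ω U₀ Gp Δ2 a hposπ hQ) :
    QFun (phiRec N) (QOfRecord F N k U₀)
      (JetSup.equiv _ _ (nabla115 ((F.P K).eta k) (unitsOfRecord F N U₀))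
        (solOfRecordC F N K k Ω U₀ levB Gp Δ2 a hposπ hposb hQ εC ε₄ Z + frakAOfRecordAtBg128C F N K k Ω U₀ levB Gp Δ2 a hposπ hQ Z)) =
      QFun (phiRec N) (QOfRecord F N k U₀)
        (JetSup.equiv _ _ (nabla115 ((F.P K).eta k) (unitsOfRecord F N U₀)) (frakAOfRecordAtBg128C F N K k Ω U₀ levB Gp Δ2 a hposπ hQ Z)) := by
  have e := map_add (jetLinearEquiv (F.L : ℝ) ((F.P K).eta k) (bondLevLit F Ω k) (pairLevLit F Ω k) (nabla115 ((F.P K).eta k) (unitsOfRecord F N U₀)))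
    (solOfRecordC F N K k Ω U₀ levB Gp Δ2 a hposπ hposb hQ εC ε₄ Z) (frakAOfRecordAtBg128C F N K k Ω U₀ levB Gp Δ2 a hposπ hQ Z)
  simp only [jetLinearEquiv_apply] at e
  rw [e, map_add, solOfRecordC_Q F N K k Ω U₀ levB Gp Δ2 a hposπ hposb hQ R hJ h𝔄 h𝔊, zero_add]

/-! ## §3. On the domain, from 3a's `RegimeTok` -/

/-- ★ **THE EL EQUATION (116) ON THE DOMAIN FROM `RegimeTok`** (3a's token; 3i′ discharges it from (117), Prop. 4, (28), (103)).
[cite: Balaban1985Variational, (116) p.295, Prop. 6 p.295] -/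
theorem bgSchemeOfRecord_sol_eq116_of_regimeTok {dom : Set (GaugeField (F.P K) k (SU N))} {εC B₀ C₄ a₃ j a𝔄 ε₄ : ℝ}
    (hT : (bgSchemeOfRecord F N K k Ω U₀ dom levB Gp Δ2 a hposπ hposb hQ εC B₀ C₄ a₃ j a𝔄 ε₄).RegimeTok) {V : GaugeField (F.P K) k (SU N)} (hV : V ∈ dom) :
    (bgSchemeOfRecord F N K k Ω U₀ dom levB Gp Δ2 a hposπ hposb hQ εC B₀ C₄ a₃ j a𝔄 ε₄).sol V =
      -(frakGOfRecordAtBg128 F N K k Ω U₀ Gp Δ2 a hposπ hQ (JOfRecordAtBg F N K k Ω U₀)) -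
        frakGOfRecordAtBg128 F N K k Ω U₀ Gp Δ2 a hposπ hQ (WOfRecordAt F N K k Ω U₀ levB a hposb hQ εC Gp
          ((bgSchemeOfRecord F N K k Ω U₀ dom levB Gp Δ2 a hposπ hposb hQ εC B₀ C₄ a₃ j a𝔄 ε₄).sol V + frakAOfRecordAtBg128 F N K k Ω U₀ levB Gp Δ2 a hposπ hQ V)) :=
  bgSchemeOfRecord_sol_eq116 F N K k Ω U₀ levB Gp Δ2 a hposπ hposb hQ dom (hT V hV).1 (hT V hV).2.1 (hT V hV).2.2

/-- ★ **(109) ON THE DOMAIN FROM `RegimeTok` AND THE SLICE LETTER**: `𝒜(V) ∈ (102)` for every `V ∈ dom`. [cite: Balaban1985Variational, (109) p.294, Prop. 6 p.295] -/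
theorem bgSchemeOfRecord_sol_mem_constraint102_of_regimeTok {dom : Set (GaugeField (F.P K) k (SU N))} {εC B₀ C₄ a₃ j a𝔄 ε₄ : ℝ}
    (hT : (bgSchemeOfRecord F N K k Ω U₀ dom levB Gp Δ2 a hposπ hposb hQ εC B₀ C₄ a₃ j a𝔄 ε₄).RegimeTok)
    (h𝔊 : FrakGSliceTok F N K k Ω U₀ Gp Δ2 a hposπ hQ) {V : GaugeField (F.P K) k (SU N)} (hV : V ∈ dom) :
    (bgSchemeOfRecord F N K k Ω U₀ dom levB Gp Δ2 a hposπ hposb hQ εC B₀ C₄ a₃ j a𝔄 ε₄).sol V ∈ constraint102OfRecord F N K k Ω U₀ :=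
  bgSchemeOfRecord_sol_mem_constraint102 F N K k Ω U₀ levB Gp Δ2 a hposπ hposb hQ dom (hT V hV).1 (hT V hV).2.1 (hT V hV).2.2 h𝔊

/-- ★ **THE EL EQUATION AT THE COMPLEX SLICE ON A SET WHERE `‖𝔄ᶜ‖ < a`, FROM `RegimeTok`** (any `V₀ ∈ dom` supplies the regime of the data).
[cite: Balaban1985Variational, (116) p.295, Prop. 9 p.309] -/
theorem solOfRecordC_eq116_of_regimeTok {dom : Set (GaugeField (F.P K) k (SU N))} {εC B₀ C₄ a₃ j a𝔄 ε₄ : ℝ}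
    (hT : (bgSchemeOfRecord F N K k Ω U₀ dom levB Gp Δ2 a hposπ hposb hQ εC B₀ C₄ a₃ j a𝔄 ε₄).RegimeTok) {V₀ : GaugeField (F.P K) k (SU N)}
    (hV₀ : V₀ ∈ dom) {Z : PBond (F.P K) k → Matrix (Fin N) (Fin N) ℂ} (h𝔄 : ‖frakAOfRecordAtBg128C F N K k Ω U₀ levB Gp Δ2 a hposπ hQ Z‖ < a𝔄) :
    solOfRecordC F N K k Ω U₀ levB Gp Δ2 a hposπ hposb hQ εC ε₄ Z =
      -(frakGOfRecordAtBg128 F N K k Ω U₀ Gp Δ2 a hposπ hQ (JOfRecordAtBg F N K k Ω U₀)) -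
        frakGOfRecordAtBg128 F N K k Ω U₀ Gp Δ2 a hposπ hQ (WOfRecordAt F N K k Ω U₀ levB a hposb hQ εC Gp
          (solOfRecordC F N K k Ω U₀ levB Gp Δ2 a hposπ hposb hQ εC ε₄ Z + frakAOfRecordAtBg128C F N K k Ω U₀ levB Gp Δ2 a hposπ hQ Z)) :=
  solOfRecordC_eq116 F N K k Ω U₀ levB Gp Δ2 a hposπ hposb hQ (hT V₀ hV₀).1 (hT V₀ hV₀).2.1 h𝔄

end Slots

end Record

end Literature.MathematicalPhysics.QuantumFieldTheory.Balaban1983to89.Node00
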